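import Literature.Analysis.FluidPDE.LerayHopfTimeSliceForced
import Literature.MeasureTheory.Lebesgue.SaturatedNonmeasurableSet
import Literature.MeasureTheory.Lebesgue.VitaliSet

/-!
# KJ-1 kernel: the typed force class `MemLqLp 1 2 f (Ioo 0 T')` admits NON-BOCHNER forces

Cell `ns-blowup`, seat `ns-blowup-refuter` (g10), KILLSHEET §XXIV row KJ-1 (planner RULING STATUS l.1660 (2):
"turn the `_memLp` junk-force K-note into a hygiene row or a ¬-lemma"). LABEL: refuter kernel certificate;
negative-side HYGIENE lemma for the forced-uniqueness slot of `route-NavierStokesRegularity-PalasekTowerBreakdown`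
(item `TaoForcedUniqueness`; PATH B / B′ of the cell). WHAT THIS IS NOT: not Navier–Stokes evidence; no
`¬ sohr2001_serrinMasuda_uniqueness_forced_memLp` is claimed IN THIS FILE; nothing about flows.
ERRATUM (v2, KILLSHEET §XXIV-E): v1 of this docblock said "KJ-1 shows none exists" — that was WRONG and is
retracted: a `¬` DOES exist (cell seat `ns-blowup-refuter4`, KILLSHEET §XXV K54): a COUNTABLE family of junk
force directions `Φ_m ⊥ U`, total modulo `U`, switched on a countable partition of the time axis into
outer-full pieces (landed infrastructure: `SaturatedPartition.lean` in this directory —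
`exists_saturated_partition`, `ae_eq_of_aestronglyMeasurable_label`) voids the typed weak form for datum `0`,
so `u_ε = ε t • U` are typed Leray–Hopf solutions for all small `ε` and uniqueness fails in the Serrin class;
the facts are refuted-MISSTATED with the one-binder repair below. The single switched force of this file is
the finite-direction special case and remains the measurability witness it was.

The Literature fact `Literature.Analysis.FluidPDE.sohr2001_serrinMasuda_uniqueness_forced_memLp` (and its
unguarded twin) types Sohr's force class `f ∈ L¹_loc([0,T); L²(ℝ³))` — a BOCHNER class, strongly measurable
in time — by `∀ T' ∈ (0,T), MemLqLp 1 2 f (Ioo 0 T')`, and `MemLqLp` (accepted, `LerayHopf.lean`) demands no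
measurability in time ("v0 simplification"). This file exhibits the SURPLUS in the kernel: for the switched
force `f(t,x) = 𝟙_M(t) g(x)` with `M ⊆ ℝ` Halmos-saturated (every measurable subset of `M` and of `Mᶜ` is
null; tree `exists_saturated_real`) and `g = 𝟙_{B(0,1)} e₀`,
* every slice is in `L²`, and `MemLqLp 1 2 f S` holds for EVERY time set `S` — indeed with mixed norm
  `eLqLpNorm 1 2 f S = 0` (lower integrals do not see a set of inner measure zero);
* yet `f` is not a.e. zero on `(0,T)` (the set `M` has full outer measure), and
* `uncurry f` is NOT a.e.-strongly measurable on `(0,T) × ℝ³`: otherwise the force pairing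
  `t ↦ ∫⟪f t, g⟫ = ‖g‖₂² 𝟙_M(t)` would be a.e.-measurable (tree `aestronglyMeasurable_forcePairing`, the
  bookkeeping step of Sohr V.1.4.1) and `M` would be null-measurable in `(0,T)`.
So the typed class is strictly larger than print, and on the surplus every Bochner integral of the weak
formulation that contains the force takes its junk value (KILLSHEET §XXIV for the desk consequences and the
one-hypothesis repair `AEStronglyMeasurable (uncurry f) ((volume.restrict (Ioo 0 T)).prod volume)`, the
shape already used by `LerayHopfTimeSliceForced`).

References: H. Sohr, *The Navier–Stokes Equations*, Birkhäuser 2001, Ch. V, Thm. 1.5.1 and §1.4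
[cite: Sohr2001, Ch. V Thm. 1.5.1]; P. R. Halmos, *Measure Theory* (1950), §16 Thm. E [cite: Halmos1950, §16 Theorem E].
-/

noncomputable section

namespace Summit.NavierStokesRegularity.ForcedUniquenessHygiene

open MeasureTheory Set Function Filter
open scoped ENNReal NNReal RealInnerProductSpace
open Literature.Analysis.FluidPDE
open Literature.MeasureTheory.Lebesgue Literature.MeasureTheory.Lebesgue.Vitali

/-! ## §1 Saturated sets have full outer measure -/

/-- A set whose complement has inner measure zero meets every measurable set of positive measure in a set
of positive OUTER measure (Halmos 1950, §16: `μ^*(M ∩ E) = μ(E)`). [cite: Halmos1950, §16 Theorem E] -/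
theorem measure_inter_ne_zero_of_innerNull_compl {M S : Set ℝ}
    (hMc : ∀ F : Set ℝ, MeasurableSet F → F ⊆ Mᶜ → volume F = 0) (hS : MeasurableSet S)
    (hS0 : volume S ≠ 0) : volume (M ∩ S) ≠ 0 := by
  intro h0
  obtain ⟨N, hMN, hN, hN0⟩ := exists_measurable_superset_of_null h0
  have hdiff : volume (S \ N) = 0 :=
    hMc (S \ N) (hS.diff hN) fun t ⟨htS, htN⟩ htM => htN (hMN ⟨htM, htS⟩)
  apply hS0
  refine le_antisymm ?_ bot_le
  calc volume S ≤ volume (S \ N ∪ N) := measure_mono (fun t ht => by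
          by_cases htN : t ∈ N
          · exact Or.inr htN
          · exact Or.inl ⟨ht, htN⟩)
    _ ≤ volume (S \ N) + volume N := measure_union_le _ _
    _ = 0 := by rw [hdiff, hN0, add_zero]

/-- Hence a saturated set (inner measure zero, complement of inner measure zero) is null-measurable for NO
restriction `volume.restrict S` to a measurable set of positive measure (Halmos 1950, §16 Thm. E).
[cite: Halmos1950, §16 Theorem E] -/
theorem not_nullMeasurableSet_restrict_of_saturated {M S : Set ℝ}
    (hM : ∀ F : Set ℝ, MeasurableSet F → F ⊆ M → volume F = 0)
    (hMc : ∀ F : Set ℝ, MeasurableSet F → F ⊆ Mᶜ → volume F = 0) (hS : MeasurableSet S)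
    (hS0 : volume S ≠ 0) : ¬ NullMeasurableSet M (volume.restrict S) := by
  refine not_nullMeasurableSet_of_subset (A := M) (W := univ) (innerNull_restrict hM S) ?_
    (fun t ht => ht.1) (fun t ht => ht)
  rw [inter_univ, Measure.restrict_apply' hS]
  exact measure_inter_ne_zero_of_innerNull_compl hMc hS hS0

/-! ## §2 The switched force `𝟙_M(t) g(x)` -/

/-- The switched force `f(t) = g` for `t ∈ M`, `f(t) = 0` otherwise. [folklore] -/
def switchedForce (M : Set ℝ) (g : (EuclideanSpace ℝ (Fin 3)) → (EuclideanSpace ℝ (Fin 3))) : ℝ → (EuclideanSpace ℝ (Fin 3)) → (EuclideanSpace ℝ (Fin 3)) :=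
  M.indicator fun _ => g

/-- On `M` the switched force is `g`. [folklore] -/
theorem switchedForce_of_mem {M : Set ℝ} {g : (EuclideanSpace ℝ (Fin 3)) → (EuclideanSpace ℝ (Fin 3))} {t : ℝ} (ht : t ∈ M) :
    switchedForce M g t = g :=
  indicator_of_mem ht _

/-- Off `M` the switched force is `0`. [folklore] -/
theorem switchedForce_of_not_mem {M : Set ℝ} {g : (EuclideanSpace ℝ (Fin 3)) → (EuclideanSpace ℝ (Fin 3))} {t : ℝ} (ht : t ∉ M) :
    switchedForce M g t = 0 :=
  indicator_of_notMem ht _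

/-- Every slice of the switched force is `g` or `0`, hence in `L²` when `g` is. [folklore] -/
theorem memLp_switchedForce {M : Set ℝ} {g : (EuclideanSpace ℝ (Fin 3)) → (EuclideanSpace ℝ (Fin 3))} (hg : MemLp g 2 volume) (t : ℝ) :
    MemLp (switchedForce M g t) 2 volume := by
  by_cases ht : t ∈ M
  · rw [switchedForce_of_mem ht]; exact hg
  · rw [switchedForce_of_not_mem ht]; exact MemLp.zero'

/-- **The mixed `L¹_t L^p_x` norm does not see the switch**: if `M` has inner measure zero, the switched
force has `eLqLpNorm 1 p f S = 0` for every time set `S` (the integrand `t ↦ ‖f t‖_{L^p}` vanishes off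
`M`, and lower Lebesgue integrals are suprema over measurable minorants; Halmos 1950, §16).
[cite: Halmos1950, §16 Theorem E] -/
theorem eLqLpNorm_one_switchedForce_eq_zero {M : Set ℝ}
    (hM : ∀ F : Set ℝ, MeasurableSet F → F ⊆ M → volume F = 0) (p : ℝ≥0∞) (g : (EuclideanSpace ℝ (Fin 3)) → (EuclideanSpace ℝ (Fin 3)))
    (S : Set ℝ) : eLqLpNorm 1 p (switchedForce M g) S = 0 := by
  rw [eLqLpNorm_def, eLpNorm_one_eq_lintegral_enorm]
  refine lintegral_eq_zero_of_innerNull (innerNull_restrict hM S) fun t ht => ?_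
  simp [switchedForce_of_not_mem ht]

/-- Hence the switched force lies in the typed class `MemLqLp 1 2 f S` for EVERY time set `S` — in
particular it satisfies the force hypothesis `∀ T' ∈ (0,T), MemLqLp 1 2 f (Ioo 0 T')` of
`sohr2001_serrinMasuda_uniqueness_forced_memLp`. [folklore] -/
theorem memLqLp_switchedForce {M : Set ℝ}
    (hM : ∀ F : Set ℝ, MeasurableSet F → F ⊆ M → volume F = 0) {g : (EuclideanSpace ℝ (Fin 3)) → (EuclideanSpace ℝ (Fin 3))}
    (hg : MemLp g 2 volume) (S : Set ℝ) : MemLqLp 1 2 (switchedForce M g) S := by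
  refine ⟨Eventually.of_forall fun t => memLp_switchedForce hg t, ?_⟩
  rw [eLqLpNorm_one_switchedForce_eq_zero hM]
  exact ENNReal.zero_lt_top

/-- **The switched force is not a.e. zero in time** when `Mᶜ` has inner measure zero and `g ≠ 0`:
`{t | f t ≠ 0} = M` has full outer measure in `(0,T)`. [cite: Halmos1950, §16 Theorem E] -/
theorem not_ae_switchedForce_eq_zero {M : Set ℝ}
    (hMc : ∀ F : Set ℝ, MeasurableSet F → F ⊆ Mᶜ → volume F = 0) {g : (EuclideanSpace ℝ (Fin 3)) → (EuclideanSpace ℝ (Fin 3))} (hg0 : g ≠ 0)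
    {T : ℝ} (hT : 0 < T) :
    ¬ (∀ᵐ t ∂(volume.restrict (Ioo 0 T)), switchedForce M g t = 0) := by
  intro h
  rw [ae_iff, Measure.restrict_apply' measurableSet_Ioo] at h
  have hset : {t : ℝ | ¬ switchedForce M g t = 0} = M := by
    ext t
    by_cases ht : t ∈ M
    · simp [switchedForce_of_mem ht, hg0, ht]
    · simp [switchedForce_of_not_mem ht, ht]
  rw [hset] at h
  exact measure_inter_ne_zero_of_innerNull_compl hMc measurableSet_Ioo
    (by rw [Real.volume_Ioo]; exact (ENNReal.ofReal_pos.2 (by linarith)).ne') h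

/-! ## §3 The switched force is not jointly a.e.-strongly measurable -/

/-- The preimage of `{c}` under the switched constant `𝟙_M · c`, `c ≠ 0`, is `M`. [folklore] -/
theorem indicator_const_preimage_singleton_self {c : ℝ} (hc : c ≠ 0) {M : Set ℝ} :
    (M.indicator fun _ => c) ⁻¹' {c} = M := by
  ext t
  by_cases ht : t ∈ M
  · simp [ht]
  · simp [ht, Ne.symm hc]

/-- The force pairing of the switched force with `g` itself is the switched constant
`t ↦ 𝟙_M(t) ∫⟪g, g⟫`. [folklore] -/
theorem forcePairing_switchedForce {M : Set ℝ} (g : (EuclideanSpace ℝ (Fin 3)) → (EuclideanSpace ℝ (Fin 3))) (t : ℝ) :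
    ∫ x, ⟪switchedForce M g t x, g x⟫ = M.indicator (fun _ => ∫ x, ⟪g x, g x⟫) t := by
  by_cases ht : t ∈ M
  · rw [switchedForce_of_mem ht, indicator_of_mem ht]
  · rw [switchedForce_of_not_mem ht, indicator_of_notMem ht]
    simp

/-- **Non-measurability.** For `M` saturated and `g ∈ L²` with `∫⟪g,g⟫ ≠ 0`, the switched force is NOT
a.e.-strongly measurable on `(0,T) × ℝ³` (`T > 0`): else its pairing with `g` — the switched constant
`‖g‖₂² 𝟙_M` — would be a.e.-measurable on `(0,T)` by the accepted `aestronglyMeasurable_forcePairing`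
(Fubini bookkeeping of Sohr V.1.4.1), making `M` null-measurable for `volume.restrict (Ioo 0 T)`.
[cite: Sohr2001, Ch. V §1.4, proof of Thm. 1.4.1 (bookkeeping step)] -/
theorem not_aestronglyMeasurable_switchedForce {M : Set ℝ}
    (hM : ∀ F : Set ℝ, MeasurableSet F → F ⊆ M → volume F = 0)
    (hMc : ∀ F : Set ℝ, MeasurableSet F → F ⊆ Mᶜ → volume F = 0) {g : (EuclideanSpace ℝ (Fin 3)) → (EuclideanSpace ℝ (Fin 3))}
    (hg : MemLp g 2 volume) (hgg : ∫ x, ⟪g x, g x⟫ ≠ 0) {T : ℝ} (hT : 0 < T) :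
    ¬ AEStronglyMeasurable (uncurry (switchedForce M g))
      ((volume.restrict (Ioo 0 T)).prod (volume : Measure (EuclideanSpace ℝ (Fin 3)))) := by
  intro hfm
  have hpair := aestronglyMeasurable_forcePairing (T := T) hfm hg.aestronglyMeasurable
  have hfun : (fun s => ∫ x, ⟪switchedForce M g s x, g x⟫) =
      M.indicator (fun _ => ∫ x, ⟪g x, g x⟫) := funext (forcePairing_switchedForce g)
  rw [hfun] at hpair
  have hnull : NullMeasurableSet M (volume.restrict (Ioo 0 T)) := by
    have hpre : NullMeasurableSet ((M.indicator fun _ => ∫ x, ⟪g x, g x⟫) ⁻¹' {∫ x, ⟪g x, g x⟫})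
        (volume.restrict (Ioo 0 T)) :=
      hpair.aemeasurable.nullMeasurable (measurableSet_singleton _)
    rwa [indicator_const_preimage_singleton_self hgg] at hpre
  exact not_nullMeasurableSet_restrict_of_saturated hM hMc measurableSet_Ioo
    (by rw [Real.volume_Ioo]; exact (ENNReal.ofReal_pos.2 (by linarith)).ne') hnull

/-! ## §4 A concrete `g` and the packaged witness -/

/-- The test field `g = 𝟙_{B̄(0,1)} e₀ ∈ L²(ℝ³; ℝ³)`. [folklore] -/
def bumpField : (EuclideanSpace ℝ (Fin 3)) → (EuclideanSpace ℝ (Fin 3)) :=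
  (Metric.closedBall (0 : (EuclideanSpace ℝ (Fin 3))) 1).indicator fun _ => EuclideanSpace.single 0 1

/-- The test field is in `L²` (bounded, supported in a ball). [folklore] -/
theorem memLp_bumpField : MemLp bumpField 2 volume :=
  memLp_indicator_const 2 Metric.isClosed_closedBall.measurableSet _
    (Or.inr (measure_closedBall_lt_top (x := (0 : (EuclideanSpace ℝ (Fin 3)))) (r := 1)).ne)

/-- The test field is not the zero field (it is `e₀` at the origin). [folklore] -/
theorem bumpField_ne_zero : bumpField ≠ 0 := by
  intro h
  have h0 := congr_fun h 0
  simp [bumpField] at h0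

/-- `∫⟪g, g⟫ = vol(B̄(0,1)) > 0` for the test field. [folklore] -/
theorem integral_inner_bumpField_ne_zero : ∫ x, ⟪bumpField x, bumpField x⟫ ≠ 0 := by
  have hpt : ∀ x, ⟪bumpField x, bumpField x⟫ =
      (Metric.closedBall (0 : (EuclideanSpace ℝ (Fin 3))) 1).indicator (fun _ => (1 : ℝ)) x := by
    intro x
    by_cases hx : x ∈ Metric.closedBall (0 : (EuclideanSpace ℝ (Fin 3))) 1
    · simp [bumpField, indicator_of_mem hx]
    · simp [bumpField, indicator_of_notMem hx]
  simp_rw [hpt]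
  rw [integral_indicator_const _ Metric.isClosed_closedBall.measurableSet, smul_eq_mul, mul_one]
  exact (ENNReal.toReal_pos (Metric.measure_closedBall_pos volume (0 : (EuclideanSpace ℝ (Fin 3))) zero_lt_one).ne'
    (measure_closedBall_lt_top).ne).ne'

/-- **KJ-1 witness (packaged).** For every `T > 0` there is a force `f : ℝ → ℝ³ → ℝ³` with all slices in
`L²`, lying in the typed class `MemLqLp 1 2 f S` for EVERY time set `S` (so the force hypothesis of
`sohr2001_serrinMasuda_uniqueness_forced_memLp` holds) with mixed norm `0`, which is NOT a.e. zero on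
`(0,T)` and whose `uncurry` is NOT a.e.-strongly measurable on `(0,T) × ℝ³` — i.e. it lies outside Sohr's
Bochner class `L¹(0,T; L²)`. [cite: Sohr2001, Ch. V Thm. 1.5.1] -/
theorem exists_memLqLp_force_not_aestronglyMeasurable {T : ℝ} (hT : 0 < T) :
    ∃ f : ℝ → (EuclideanSpace ℝ (Fin 3)) → (EuclideanSpace ℝ (Fin 3)),
      (∀ t, MemLp (f t) 2 volume) ∧ (∀ S : Set ℝ, MemLqLp 1 2 f S) ∧
        (∀ S : Set ℝ, eLqLpNorm 1 2 f S = 0) ∧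
          ¬ (∀ᵐ t ∂(volume.restrict (Ioo 0 T)), f t = 0) ∧
            ¬ AEStronglyMeasurable (uncurry f) ((volume.restrict (Ioo 0 T)).prod (volume : Measure (EuclideanSpace ℝ (Fin 3)))) := by
  obtain ⟨M, hM, hMc⟩ := exists_saturated_real
  exact ⟨switchedForce M bumpField, memLp_switchedForce memLp_bumpField,
    memLqLp_switchedForce hM memLp_bumpField, eLqLpNorm_one_switchedForce_eq_zero hM 2 bumpField,
    not_ae_switchedForce_eq_zero hMc bumpField_ne_zero hT,
    not_aestronglyMeasurable_switchedForce hM hMc memLp_bumpField integral_inner_bumpField_ne_zero hT⟩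

/-- **Corollary (the hypothesis list of the Sohr fact is met by a non-Bochner force).** For every `T > 0`
there is a force satisfying `∀ T', 0 < T' → T' < T → MemLqLp 1 2 f (Ioo 0 T')` verbatim — the force
hypothesis `_hf` of `sohr2001_serrinMasuda_uniqueness_forced_memLp` — that is not jointly a.e.-strongly
measurable on `(0,T) × ℝ³`. [cite: Sohr2001, Ch. V Thm. 1.5.1] -/
theorem exists_sohrForceHypothesis_not_aestronglyMeasurable {T : ℝ} (hT : 0 < T) :
    ∃ f : ℝ → (EuclideanSpace ℝ (Fin 3)) → (EuclideanSpace ℝ (Fin 3)),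
      (∀ T', 0 < T' → T' < T → MemLqLp 1 2 f (Ioo 0 T')) ∧
        ¬ AEStronglyMeasurable (uncurry f) ((volume.restrict (Ioo 0 T)).prod (volume : Measure (EuclideanSpace ℝ (Fin 3)))) := by
  obtain ⟨f, -, hmem, -, -, hnm⟩ := exists_memLqLp_force_not_aestronglyMeasurable hT
  exact ⟨f, fun T' _ _ => hmem (Ioo 0 T'), hnm⟩

end Summit.NavierStokesRegularity.ForcedUniquenessHygiene

end
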